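import Summits.QuantumFields.YangMills.Theses.RandomisedStokes
import Summits.QuantumFields.YangMills.Theorems.SmallFieldWideningLargeFieldMassRefinementTailOfFirstExit
import Summits.QuantumFields.YangMills.Theorems.FirstExitWindowOneStepWindowL
import Summits.QuantumFields.YangMills.Theorems.RandomisedStokesOffSliver
import Summits.QuantumFields.YangMills.Theorems.RandomisedStokesOffSliverArith
import Summits.QuantumFields.YangMills.Theorems.RandomisedStokesOffSliverArithX
import Literature.MathematicalPhysics.QuantumFieldTheory.Balaban1983to89.T3MinimiserStabilityReduction

/-!
# Route `RandomisedStokes` (LINE 18 of ideator ym-r3-idea-2 g8 on crux stmt-QuantumFields-19936 `UnitScaleTilt.HistoryTailL`):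
# THE GLUE `HistoryTailOfChaosL` (support item stmt-QuantumFields-23887 = registered `stub_glue` of `Lines/randomised_stokes.lean`), PROVED

`RectangleTailL → ChaosSuppressedDominationL → ThinDeepWindowTailL → UnitScaleTilt.HistoryTailL` (route rev 1: the residual
`ThinDeepWindowTailL` is the repaired item stmt-QuantumFields-23919, inner prefactor exponent `N'`).

THE ARGUMENT (pattern of the landed `firstExitWindow_historyTailOfFirstExit_proof`).  Given `L`, take the rectangle constants
`(α_R, c_R, C_R, A_R)` and the chaos constants `(D, R, α_X, c_X, C_X, A_X)`; the sliver exponent `N = ⌈2 + 2/α_R + 2/α_X⌉₊` (so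
`(2N−3)α_R > 1`, `(N−1)α_X > 1`); the profile `b₀ = max b₁ 1`, `p₀ = max p₁ (max N 3)`; the window `b₂, γ_W` of the landed
`firstExitWindow_oneStepWindowL_proof`; the sliver tail `γ_T, C_T, c_T, N'` of `ThinDeepWindowTailL` at `(L, N, b₀, p₀, b₂)`; `γ₁ = min γ_W γ_T`.
For a family `F` (`F.L = L`) and `0 < γ ≤ γ₁`: the bare profile is the tree's `T3BareTailProfile.bareTailAt`; the finest-bad-level event at
level `j ≥ 1` lies in the union over the `≤ 9·(2L^{m+K−j})³` level-`j` plaquettes of their first-exit events (window + landed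
`real_finestBad_le_card_mul`); ON the sliver `(j+1)^N > p(g_{K−j})` each first-exit event is paid by `ThinDeepWindowTailL` and the count by the
tree's `exists_perHeight_bound`; OFF the sliver the first-exit event lies in `{θ(K−j) ≤ dist1(Ū^j(∂p))}`, paid by the engine
`RandomisedStokesOffSliver.perPlaquette_offSliver` (rectangle union + chaos) and the count by `RandomisedStokesOffSliverArith.offSliver_R_term` /
`RandomisedStokesOffSliverArithX.offSliver_X_term`; both give a geometric profile `A'·2^{−(K−j)}`, and
`HistoryTailOfTwoSided.historyTailAt_of_bare_finestBad` assembles `HistoryTailAt F γ b₀ p₀ m` for every free top fraction `1/m`.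

WHAT THIS IS NOT: the three cruxes `RectangleTailL` (23864), `ChaosSuppressedDominationL` (23885), `ThinDeepWindowTailL` (23919) are OPEN
hypotheses — this is the route's bookkeeping; no tail estimate is proved, rung R3 (`YM3TorusSU2`) is a RECORD rung, not the Clay statement,
and nothing here bears on the Yang–Mills mass gap.  Cell `ym-idea-1`, LEAD seat `ym-line-sfw-p2` g71 (free hands; own crux
stmt-QuantumFields-22884 has no provable delta), `--workitem stmt-QuantumFields-23887`.
References: T. Bałaban, CMP 102 (1985) 255–275 [Balaban1985UV3] ((7) p.257, (71) p.273); C. King, CMP 103 (1986) 323–349 [King1986].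
-/

set_option autoImplicit false

noncomputable section

open MeasureTheory Filter Topology
open Literature.MathematicalPhysics.QuantumFieldTheory.Balaban1983to89
open Literature.MathematicalPhysics.QuantumFieldTheory.Balaban1983to89.Missing
open Literature.MathematicalPhysics.QuantumFieldTheory.Balaban1983to89.T3ContinuumYM3Torus
open Literature.MathematicalPhysics.QuantumFieldTheory.Balaban1983to89.T3UnitScaleTilt
open Literature.MathematicalPhysics.QuantumFieldTheory.Balaban1983to89.T3UnitLawDensityEML (ℰp)
open Literature.MathematicalPhysics.QuantumFieldTheory.Balaban1983to89.T3BareTailProfile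
open Summit.QuantumFields.YangMills.Theorems.HistoryTailOfTwoSided
open Summit.QuantumFields.YangMills.Theorems.LargeFieldMassRefinementTailOfFirstExit
open Summit.QuantumFields.YangMills.Theorems.RandomisedStokesOffSliver
open Summit.QuantumFields.YangMills.Theorems.RandomisedStokesOffSliverArith
open Summit.QuantumFields.YangMills.Theorems.RandomisedStokesOffSliverArithX

namespace Summit.QuantumFields.YangMills.Theorems.RandomisedStokesHistoryTailOfChaos

/-! ## §1 The finest-bad-level profile of one family from the three tail hypotheses -/

/-- **THE FINEST-BAD-LEVEL PROFILE FROM RECTANGLE TAILS + CHAOS SUPPRESSION + THE SLIVER TAIL** (one family `F`, one coupling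
`0 < γ ≤ 1`; `b₀ ≥ 1`, `p₀ ≥ 1`, `N ≤ p₀`, `N ≥ 3`, `(2N−3)α_R > 1`, `(N−1)α_X > 1`): given the one-step window `b₀ → b₂`, the sliver first-exit
tail (`(j+1)^N > p(g_{K−j})`), the rectangle tail and the chaos bound (all for `F` at `γ`, stated structurally), there is `A' ≥ 0` with
`Gibbs_K(finest bad level = j) ≤ A'·2^{−(K−j)}` for all `1 ≤ j ≤ K`. [cite: Balaban1985UV3, (7) p.257 and (71) p.273] -/
theorem exists_finestBad_profile_of_chaos (F : T3Family) {γ b₀ b₂ p₀ : ℝ} (hγ : 0 < γ) (hγ1 : γ ≤ 1) (hb₀ : 1 ≤ b₀)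
    (hp₀ : 1 ≤ p₀) {N : ℕ} (hNp₀ : (N : ℝ) ≤ p₀) (hN3 : 3 ≤ N)
    {D R αR cR CR αX cX CX CT cT : ℝ} {AR AX NT : ℕ} (hD : 1 ≤ D) (hR : 2 ≤ R) (hαR : 0 < αR) (hcR : 0 < cR) (hCR : 0 ≤ CR)
    (hαX : 0 < αX) (hcX : 0 < cX) (hCX : 0 ≤ CX) (hcT : 0 < cT)
    (heR : 1 < ((2 * N - 3 : ℕ) : ℝ) * αR) (heX : 1 < ((N - 1 : ℕ) : ℝ) * αX)
    (hW : ∀ K j : ℕ, j + 1 ≤ K → ∀ U : GaugeField (F.P K) 0 (Matrix.specialUnitaryGroup (Fin 2) ℂ),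
      PlaqSmall (θBal F.L γ b₀ p₀ (K - j))
          (Averaging.iter (fun i => BlockAveraging.blockAvg (P := F.P K) (j := i) ℰp) j U) →
        PlaqSmall (θBal F.L γ b₂ p₀ (K - (j + 1)))
          (Averaging.iter (fun i => BlockAveraging.blockAvg (P := F.P K) (j := i) ℰp) (j + 1) U))
    (hTT : ∀ K j : ℕ, 1 ≤ j → j ≤ K →
      ((j : ℝ) + 1) ^ N > B10.pFun b₀ p₀ (Real.sqrt (γ * ((F.L : ℝ)⁻¹) ^ (K - j))) → ∀ p : Plaq (F.P K) j,
      (gibbsK F ℰp γ K).real {U | (∀ k, k < j → PlaqSmall (θBal F.L γ b₀ p₀ (K - k))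
          (Averaging.iter (fun i => BlockAveraging.blockAvg (P := F.P K) (j := i) ℰp) k U)) ∧
        PlaqSmall (θBal F.L γ b₂ p₀ (K - j))
          (Averaging.iter (fun i => BlockAveraging.blockAvg (P := F.P K) (j := i) ℰp) j U) ∧
        θBal F.L γ b₀ p₀ (K - j) ≤ GaugeGroup.dist1 (GaugeField.plaqHol
          (Averaging.iter (fun i => BlockAveraging.blockAvg (P := F.P K) (j := i) ℰp) j U) p)} ≤
      CT * ((γ * ((F.L : ℝ)⁻¹) ^ (K - j))⁻¹) ^ NT *
        Real.exp (-(cT * B10.pFun b₀ p₀ (Real.sqrt (γ * ((F.L : ℝ)⁻¹) ^ (K - j))) ^ 2)))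
    (hRR : ∀ (K a b : ℕ) (x : Site (F.P K) 0) (μ ν : Fin (F.P K).d) (t : ℝ), μ ≠ ν → 1 ≤ a → 1 ≤ b →
      2 * (a + b) < (F.P K).sitesPerDir 0 → 0 < t → t ≤ 1 →
        (gibbsK F ℰp γ K).real {U | t ≤ GaugeGroup.dist1 (Missing.pathHol U (Missing.rectLoop x μ ν a b))} ≤
          CR * (F.scheme ℰp γ).β K ^ AR * ((a : ℝ) + b) ^ AR *
            Real.exp (-((cR * (t ^ 2 * (F.scheme ℰp γ).β K / (((a : ℝ) + b) * (1 + Real.log ((a : ℝ) + b))))) ^ αR)))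
    (hXX : ∀ (K j : ℕ) (q : Plaq (F.P K) j) (η : ℝ), j ≤ K → 0 < η → η ≤ 1 →
      (gibbsK F ℰp γ K).real {U | (∀ (i a b : ℕ) (x : Site (F.P K) 0) (μ ν : Fin (F.P K).d), μ ≠ ν → i ≤ j → 1 ≤ a → 1 ≤ b →
          2 * (a + b) < (F.P K).sitesPerDir 0 → ((a : ℝ) + b) ≤ R * (F.L : ℝ) ^ i →
            GaugeGroup.dist1 (Missing.pathHol U (Missing.rectLoop x μ ν a b)) ≤ η * Real.sqrt ((F.L : ℝ) ^ i / (F.L : ℝ) ^ j)) ∧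
          D * ((j : ℝ) + 1) * η < GaugeGroup.dist1 (GaugeField.plaqHol
            (Averaging.iter (fun i => BlockAveraging.blockAvg (P := F.P K) (j := i) ℰp) j U) q)} ≤
        CX * (F.scheme ℰp γ).β K ^ AX * Real.exp (-((cX * (η / (γ * ((F.L : ℝ)⁻¹) ^ (K - j)))) ^ αX))) :
    ∃ A' : ℝ, 0 ≤ A' ∧ ∀ K j : ℕ, 1 ≤ j → j ≤ K → (gibbsK F ℰp γ K).real
      ({U | ¬ PlaqSmall (θBal F.L γ b₀ p₀ (K - j))
          (Averaging.iter (fun i => BlockAveraging.blockAvg (P := F.P K) (j := i) ℰp) j U)} ∩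
        {U | ∀ i, i < j → PlaqSmall (θBal F.L γ b₀ p₀ (K - i))
          (Averaging.iter (fun i' => BlockAveraging.blockAvg (P := F.P K) (j := i') ℰp) i U)}) ≤
      A' * ((1 : ℝ) / 2) ^ (K - j) := by
  have hb₀0 : 0 < b₀ := one_pos.trans_le hb₀
  -- the three profiles
  obtain ⟨Aon, hAon0, hPon⟩ := exists_perHeight_bound F hγ hγ1 hb₀0 hp₀ (le_max_right CT 0) NT hcT
  obtain ⟨AoR, hAoR0, hPR⟩ := offSliver_R_term F hγ hγ1 hb₀ hNp₀ hN3 hD hR hαR hcR hCR (AR := AR) heR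
  obtain ⟨AoX, hAoX0, hPX⟩ := offSliver_X_term F hγ hγ1 hb₀ hNp₀ (by omega) hD hαX hcX hCX (AX := AX) heX
  refine ⟨Aon + (AoR + AoX), by positivity, fun K j hj1 hjK => ?_⟩
  obtain ⟨j, rfl⟩ : ∃ j', j = j' + 1 := ⟨j - 1, by omega⟩
  haveI := isProbabilityMeasure_gibbsK F ℰp hγ.le K
  have hr0 : 0 ≤ ((1 : ℝ) / 2) ^ (K - (j + 1)) := by positivity
  have hcard := card_plaq_le_pow F hjK
  by_cases hsl : (((j + 1 : ℕ) : ℝ) + 1) ^ N > B10.pFun b₀ p₀ (Real.sqrt (γ * ((F.L : ℝ)⁻¹) ^ (K - (j + 1))))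
  · -- ON the sliver: the residual tail
    have hE0 : 0 ≤ max CT 0 * (F.scheme ℰp γ).β (K - (j + 1)) ^ NT *
        Real.exp (-(cT * B10.pFun b₀ p₀ (Real.sqrt (γ * ((F.L : ℝ)⁻¹) ^ (K - (j + 1)))) ^ 2)) :=
      mul_nonneg (mul_nonneg (le_max_right CT 0) (pow_nonneg (F.scheme_β_nonneg ℰp hγ.le (K - (j + 1))) NT))
        (Real.exp_nonneg _)
    have hB : ∀ p : Plaq (F.P K) (j + 1), (gibbsK F ℰp γ K).real
        {U | (∀ k, k < j + 1 → PlaqSmall (θBal F.L γ b₀ p₀ (K - k))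
            (Averaging.iter (fun i => BlockAveraging.blockAvg (P := F.P K) (j := i) ℰp) k U)) ∧
          PlaqSmall (θBal F.L γ b₂ p₀ (K - (j + 1)))
            (Averaging.iter (fun i => BlockAveraging.blockAvg (P := F.P K) (j := i) ℰp) (j + 1) U) ∧
          θBal F.L γ b₀ p₀ (K - (j + 1)) ≤ GaugeGroup.dist1 (GaugeField.plaqHol
            (Averaging.iter (fun i => BlockAveraging.blockAvg (P := F.P K) (j := i) ℰp) (j + 1) U) p)} ≤
        max CT 0 * (F.scheme ℰp γ).β (K - (j + 1)) ^ NT *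
          Real.exp (-(cT * B10.pFun b₀ p₀ (Real.sqrt (γ * ((F.L : ℝ)⁻¹) ^ (K - (j + 1)))) ^ 2)) := by
      intro p
      refine (hTT K (j + 1) hj1 hjK hsl p).trans ?_
      show CT * (F.scheme ℰp γ).β (K - (j + 1)) ^ NT *
          Real.exp (-(cT * B10.pFun b₀ p₀ (Real.sqrt (γ * ((F.L : ℝ)⁻¹) ^ (K - (j + 1)))) ^ 2)) ≤ _
      exact mul_le_mul_of_nonneg_right
        (mul_le_mul_of_nonneg_right (le_max_left CT 0) (pow_nonneg (F.scheme_β_nonneg ℰp hγ.le (K - (j + 1))) NT))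
        (Real.exp_nonneg _)
    refine (real_finestBad_le_card_mul F γ b₀ b₂ p₀ (gibbsK F ℰp γ K) (hW K j hjK) hB).trans ?_
    calc (Fintype.card (Plaq (F.P K) (j + 1)) : ℝ) * (max CT 0 * (F.scheme ℰp γ).β (K - (j + 1)) ^ NT *
          Real.exp (-(cT * B10.pFun b₀ p₀ (Real.sqrt (γ * ((F.L : ℝ)⁻¹) ^ (K - (j + 1)))) ^ 2)))
        ≤ (9 * (8 * (F.L : ℝ) ^ (3 * F.m) * ((F.L : ℝ) ^ (K - (j + 1))) ^ 3)) *
          (max CT 0 * (F.scheme ℰp γ).β (K - (j + 1)) ^ NT *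
            Real.exp (-(cT * B10.pFun b₀ p₀ (Real.sqrt (γ * ((F.L : ℝ)⁻¹) ^ (K - (j + 1)))) ^ 2))) :=
          mul_le_mul_of_nonneg_right hcard hE0
      _ ≤ Aon * ((1 : ℝ) / 2) ^ (K - (j + 1)) := hPon (K - (j + 1))
      _ ≤ (Aon + (AoR + AoX)) * ((1 : ℝ) / 2) ^ (K - (j + 1)) := by
          have : 0 ≤ (AoR + AoX) * ((1 : ℝ) / 2) ^ (K - (j + 1)) := by positivity
          linarith
  · -- OFF the sliver: rectangles + chaos
    have hoff : (((j + 1 : ℕ) : ℝ) + 1) ^ N ≤ B10.pFun b₀ p₀ (Real.sqrt (γ * ((F.L : ℝ)⁻¹) ^ (K - (j + 1)))) := not_lt.mp hsl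
    have hθ0 : 0 < θBal F.L γ b₀ p₀ (K - (j + 1)) :=
      T3MinimiserStabilityReduction.θBal_pos F.hL.2.le hγ hγ1 hb₀0 p₀ (K - (j + 1))
    -- the two off-sliver terms
    have hβ0 : 0 ≤ (F.scheme ℰp γ).β K := F.scheme_β_nonneg ℰp hγ.le K
    have hRL0 : 0 ≤ R * (F.L : ℝ) ^ (j + 1) := by positivity
    have hXT : 0 ≤ ((((j + 1 : ℕ) : ℝ) + 1) * ((⌊R * (F.L : ℝ) ^ (j + 1)⌋₊ : ℝ) + 1) ^ 2 * (((F.P K).sitesPerDir 0 : ℝ)) ^ 3 * 9) *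
        (CR * (F.scheme ℰp γ).β K ^ AR * (R * (F.L : ℝ) ^ (j + 1)) ^ AR *
          Real.exp (-((cR * ((θBal F.L γ b₀ p₀ (K - (j + 1)) / (2 * D * (((j + 1 : ℕ) : ℝ) + 1))) ^ 2 * (F.scheme ℰp γ).β K /
            (R * (F.L : ℝ) ^ (j + 1) * (1 + Real.log (R * (F.L : ℝ) ^ (j + 1)))))) ^ αR))) := by positivity
    have hXW : 0 ≤ CX * (F.scheme ℰp γ).β K ^ AX *
        Real.exp (-((cX * ((θBal F.L γ b₀ p₀ (K - (j + 1)) / (2 * D * (((j + 1 : ℕ) : ℝ) + 1))) /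
          (γ * ((F.L : ℝ)⁻¹) ^ (K - (j + 1))))) ^ αX)) := by positivity
    have hB : ∀ p : Plaq (F.P K) (j + 1), (gibbsK F ℰp γ K).real
        {U | (∀ k, k < j + 1 → PlaqSmall (θBal F.L γ b₀ p₀ (K - k))
            (Averaging.iter (fun i => BlockAveraging.blockAvg (P := F.P K) (j := i) ℰp) k U)) ∧
          PlaqSmall (θBal F.L γ b₂ p₀ (K - (j + 1)))
            (Averaging.iter (fun i => BlockAveraging.blockAvg (P := F.P K) (j := i) ℰp) (j + 1) U) ∧
          θBal F.L γ b₀ p₀ (K - (j + 1)) ≤ GaugeGroup.dist1 (GaugeField.plaqHol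
            (Averaging.iter (fun i => BlockAveraging.blockAvg (P := F.P K) (j := i) ℰp) (j + 1) U) p)} ≤
        ((((j + 1 : ℕ) : ℝ) + 1) * ((⌊R * (F.L : ℝ) ^ (j + 1)⌋₊ : ℝ) + 1) ^ 2 * (((F.P K).sitesPerDir 0 : ℝ)) ^ 3 * 9) *
            (CR * (F.scheme ℰp γ).β K ^ AR * (R * (F.L : ℝ) ^ (j + 1)) ^ AR *
              Real.exp (-((cR * ((θBal F.L γ b₀ p₀ (K - (j + 1)) / (2 * D * (((j + 1 : ℕ) : ℝ) + 1))) ^ 2 *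
                (F.scheme ℰp γ).β K / (R * (F.L : ℝ) ^ (j + 1) * (1 + Real.log (R * (F.L : ℝ) ^ (j + 1)))))) ^ αR))) +
          CX * (F.scheme ℰp γ).β K ^ AX *
            Real.exp (-((cX * ((θBal F.L γ b₀ p₀ (K - (j + 1)) / (2 * D * (((j + 1 : ℕ) : ℝ) + 1))) /
              (γ * ((F.L : ℝ)⁻¹) ^ (K - (j + 1))))) ^ αX)) := by
      intro p
      refine (measureReal_mono (fun U hU => hU.2.2) (measure_ne_top _ _)).trans ?_
      exact perPlaquette_offSliver hγ hD hR hαR hcR hCR hCX hRR hXX K (j + 1) hjK p hθ0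
    refine (real_finestBad_le_card_mul F γ b₀ b₂ p₀ (gibbsK F ℰp γ K) (hW K j hjK) hB).trans ?_
    refine (level_arith hcard hXT hXW (hPR K (j + 1) hjK hoff) (hPX K (j + 1) hjK hoff)).trans ?_
    have : 0 ≤ Aon * ((1 : ℝ) / 2) ^ (K - (j + 1)) := by positivity
    linarith

/-! ## §2 The item -/

/-- **THE GLUE `HistoryTailOfChaosL` OF ROUTE `RandomisedStokes` (support item stmt-QuantumFields-23887; = the registered `stub_glue` of
skeleton `Lines/randomised_stokes.lean`), PROVED**: `RectangleTailL → ChaosSuppressedDominationL → ThinDeepWindowTailL → UnitScaleTilt.HistoryTailL`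
— for every block size `L` and floor `(b₁, p₁)` the profile `(b₀, p₀) = (max b₁ 1, max p₁ (max N 3))`, `N = ⌈2 + 2/α_R + 2/α_X⌉₊`, and for every
`m ≥ 1` the threshold `γ₁ = min γ_W γ_T` make `HistoryTailAt F γ b₀ p₀ m` hold for every family of block size `L` and every `0 < γ ≤ γ₁`.
Nothing here proves the three cruxes, the rung R3, or anything about the mass gap. [cite: Balaban1985UV3, (7) p.257 and (71) p.273] -/
theorem randomisedStokes_historyTailOfChaosL_proof :
    Summit.QuantumFields.YangMills.Theses.RandomisedStokes.HistoryTailOfChaosL := by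
  intro hRect hChaos hThin L b₁ p₁
  -- constants at block size `L`
  obtain ⟨αR, cR, CR, AR, hαR, hcR, hCR, hRR⟩ := hRect L
  obtain ⟨D, R, αX, cX, CX, AX, hD, hR, hαX, hcX, hCX, hXX⟩ := hChaos L
  -- the sliver exponent
  obtain ⟨N, hN⟩ : ∃ N : ℕ, N = ⌈2 + 2 / αR + 2 / αX⌉₊ := ⟨_, rfl⟩
  have hNge : 2 + 2 / αR + 2 / αX ≤ (N : ℝ) := by rw [hN]; exact Nat.le_ceil _
  have h2R : 0 < 2 / αR := div_pos two_pos hαR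
  have h2X : 0 < 2 / αX := div_pos two_pos hαX
  have hN2 : (2 : ℝ) < N := by linarith
  have hN3 : 3 ≤ N := by
    have : (2 : ℕ) < N := by exact_mod_cast hN2
    omega
  have hN0 : 0 < N := by omega
  have heR : 1 < ((2 * N - 3 : ℕ) : ℝ) * αR := by
    have hcast : ((2 * N - 3 : ℕ) : ℝ) = 2 * (N : ℝ) - 3 := by
      rw [Nat.cast_sub (by omega)]; push_cast; ring
    rw [hcast]
    have h1 : 1 + 2 * (2 / αR) ≤ 2 * (N : ℝ) - 3 := by linarith [h2X.le]
    have h2 : (1 + 2 * (2 / αR)) * αR = αR + 4 := by field_simp; ring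
    have h3 := mul_le_mul_of_nonneg_right h1 hαR.le
    rw [h2] at h3
    linarith
  have heX : 1 < ((N - 1 : ℕ) : ℝ) * αX := by
    have hcast : ((N - 1 : ℕ) : ℝ) = (N : ℝ) - 1 := by
      rw [Nat.cast_sub (by omega)]; push_cast; ring
    rw [hcast]
    have h1 : 1 + 2 / αX ≤ (N : ℝ) - 1 := by linarith [h2R.le]
    have h2 : (1 + 2 / αX) * αX = αX + 2 := by field_simp
    have h3 := mul_le_mul_of_nonneg_right h1 hαX.le
    rw [h2] at h3
    linarith
  -- the profile above the floor
  obtain ⟨b₀, hb₁, hb₀1⟩ : ∃ b₀ : ℝ, b₁ ≤ b₀ ∧ 1 ≤ b₀ := ⟨max b₁ 1, le_max_left _ _, le_max_right _ _⟩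
  obtain ⟨p₀, hp₁, hNp₀, hp₀3⟩ : ∃ p₀ : ℝ, p₁ ≤ p₀ ∧ (N : ℝ) ≤ p₀ ∧ 3 ≤ p₀ :=
    ⟨max p₁ (max (N : ℝ) 3), le_max_left _ _, (le_max_left _ _).trans (le_max_right _ _),
      (le_max_right _ _).trans (le_max_right _ _)⟩
  have hb₀ : 0 < b₀ := one_pos.trans_le hb₀1
  have hp₀ : 2 < p₀ := by linarith
  have hp₀1 : 1 ≤ p₀ := by linarith
  -- the window and the sliver tail at this profile
  obtain ⟨b₂, γW, hb₂, hγW, hγW1, hWF⟩ := firstExitWindow_oneStepWindowL_proof L b₀ p₀ hb₀ hp₀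
  obtain ⟨γT, CT, cT, NT, hγT, -, hcT, hTT⟩ := hThin L N hN0 b₀ p₀ b₂ hb₀ hp₀ hNp₀ hb₂
  refine ⟨b₀, p₀, hb₁, hp₁, hb₀, hp₀, fun m hm => ⟨min γW γT, lt_min hγW hγT, fun F γ hFL hγ hle => ?_⟩⟩
  have hγW' : γ ≤ γW := hle.trans (min_le_left _ _)
  have hγT' : γ ≤ γT := hle.trans (min_le_right _ _)
  have hγ1 : γ ≤ 1 := hγW'.trans hγW1
  subst hFL
  -- the bare profile (landed) and the finest-bad-level profile (§2)
  obtain ⟨q₀, hq₀0, hq₀, -, hbare⟩ := bareTailAt F hγ hγ1 hb₀ hp₀1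
  obtain ⟨A', hA'0, hfb⟩ := exists_finestBad_profile_of_chaos F hγ hγ1 hb₀1 hp₀1 hNp₀ hN3 hD hR hαR hcR hCR hαX hcX hCX
    hcT heR heX (hWF F γ rfl hγ hγW') (hTT F γ rfl hγ hγT') (hRR F γ rfl hγ hγ1) (hXX F γ rfl hγ hγ1)
  obtain ⟨hq0, hq, hqt⟩ := geometric_profile hA'0
  exact historyTailAt_of_bare_finestBad F hγ.le b₀ p₀ hm q₀ (fun i => A' * ((1 : ℝ) / 2) ^ i)
    hq₀0 hq₀ hq0 hq hqt hbare fun K j hj1 hjK => hfb K j hj1 (by omega)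

end Summit.QuantumFields.YangMills.Theorems.RandomisedStokesHistoryTailOfChaos

end
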